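import Summits.QuantumFields.BalabanUV.Beta.RelInvBorderedHessian
import Summits.QuantumFields.BalabanUV.Beta.GAN24.FaceChargeCurlResummation

/-!
# `BalabanUV.Beta.GAN24.RelInvWardPairing` — binder row G-an2-4 ∕ (CONV-C), the (S) row of RULING R-gan24p1-g27-1 B (viii), the Ward-type half (W-γ) (road-P2 g39),
# EXIT class: **THE RELATIVE-INVERSE WARD PAIRING AT `j = 0` — `⟨(d*d) m, (G ∘ W)^F⟩ = ⟨m, W^F⟩ + ⟨𝒬_N m, (G ∘ W)^M⟩` FOR A BOUNDED 1-FORM `m` IN HARD AXIAL GAUGE**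
# (G-an2-4 formalisation swarm → CRUX TEAM (2), seat `b2b-balaban-gan24-formalise-leaf-06` = the (γ) hand, gen 46, INTENT 2)

NOT IN PRINT; OUR BOOKKEEPING ([folklore] lattice exterior calculus + an2 gen 13's bordered-Hessian ACTION LEMMA `BorderedHessian.comp_bhK_inl` and RELATIVE-INVERSE RULE 4
`(E ∘ 𝕄) ∘ G = E` (`ChartConjugationRelative.RelInv`, `E = axEc ρ N` the coarse axial coordinate projector, `𝕄 = bhK N = [[d*d, −𝒬ᵀ_N],[𝒬_N, 0]]`), instantiated BY NAME at
`G₀ = coDressKBmAt (toSite r) Lc (KInvStep Lc 0)` through `BorderedHessian.relInv_coDressKBmAt_KInvStep_zero`; 0 `def`, 0 cited fact, 0 `def … : Prop`, 0 sorry).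
HONEST FRAMING (cell contract, verbatim): «discharging `BetaPertH` makes Bałaban's UV stability UNCONDITIONAL — a real constructive-QFT result; it is NOT the continuum limit and NOT the
Clay problem.»  HONEST DEPENDENCY (verbatim): «continuum YM on T⁴ ⇐ BetaPertH ∧ nine spine estimates (0/9 proved); BetaPertH ⇐ (D1) ∧ (D4) ∧ CAP+tail; G-an2-4 gates asym, D1 and NE2/3/4.»

WHY.  leaf-06 g46 INTENT 1 (`EdgePlaquettePotential`) wrote (W-γ) in the exit class, channel `(a,b)`, as `r(e) ⊥ (d*d) m̃_ab` for a BOUNDED periodic 1-form, free up to `dz λ`; the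
(γ)∕(α⁺) read-vectors `r(e)` are field columns of kernels `G₀ ∘ W`.  This file is the one structural identity that unfolds such a pairing through the Euler–Lagrange rows of
the bordered Hessian: on every NON-comb field row the relative inverse satisfies `(𝕄 ∘ (G ∘ W)) = W` (rule 4 read through the diagonal `E`), the action lemma writes that row as
`(d*d (G∘W)^F_{·xb})_κ(u) − (𝒬ᵀ_N (G∘W)^M_{·xb})_κ(u)`, and a bounded `m` vanishing on the comb bonds pairs only with non-comb rows.
* §1 ADJOINTNESS WITH THE BOUND ON THE OTHER FACTOR: `tsum_mul_curvAdj_eq_tsum_curv_mul_bdd` (`r` BOUNDED, `F` with absolutely summable components — the mirror image of leaf-02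
  g55's `FaceChargeCurlResummation.tsum_mul_curvAdj_eq_tsum_curv_mul`), **`tsum_mul_curvAdj_curv_comm`** (`⟨m, (d*d)A⟩ = ⟨(d*d)m, A⟩` for `m` bounded, `A` absolutely summable),
  **`tsum_mul_contourSumAdj_bdd`** (`⟨m, 𝒬ᵀ_N φ⟩ = Σ'_y Σ_κ φ κ y·(𝒬_N m) κ y` for `m` bounded, `φ` absolutely summable — the mirror of `KKTFluctuationEnergy.lip1_contourSumAdj`).
* §2 **`fieldRow_eq_of_relInv`**: `RelInv G (bhK N) (axEc ρ N)`, `G` and `W` spread ⇒ on every non-comb bond `(κ, u)`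
  `curvAdj (curv (fcol (G∘W) x b)) κ u − contourSumAdj N (mcol N (G∘W) x b) κ u = W u x (inl κ) b`.
* §3 **`ward_pairing`**: for `m` bounded with `m κ u = 0` on every comb bond,
  `Σ'_u Σ_κ (curvAdj (curv m)) κ u·(G∘W) u x (inl κ) b = Σ'_u Σ_κ m κ u·W u x (inl κ) b + Σ'_y Σ_κ (contourSum N m) κ y·(G∘W) (N•y) x (inr κ) b`;
  (the left side does not see `m ↦ m − dz λ` — leaf-06 INTENT 1's `EdgePlaquettePotential.curvAdj_curv_sub_dz` — so the hard-axial representative may be chosen).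
* §4 **`ward_pairing_coDressKBmAt_KInvStep_zero`**: the instance `G₀ = coDressKBmAt (toSite r) Lc (KInvStep Lc 0)`, `r ∈ box`, every spread `W`.
Asserts NO value of any read vector or table; NOTHING of (W-γ) ∕ (T-F) ∕ (INV) ∕ (S) claimed; NEVER «G-an2-4 closed» as (CONV-C); NOT D1, NOT `BetaPertH`, NOT continuum, NOT Clay.
2026-08-22; no existing file touched.
-/

noncomputable section

open Finset
open scoped BigOperators
open Literature.Probability.LatticeModels (TorusSite Torus.proj Torus.proj_apply)
open Literature.MathematicalPhysics.QuantumFieldTheory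
open Literature.MathematicalPhysics.QuantumFieldTheory.Balaban1983to89
open Literature.MathematicalPhysics.QuantumFieldTheory.Balaban1983to89.Beta
open B12Sec2to5 (l1 l1_nonneg)
open ExpKernelCalculus (MKer Decays comp summable_exp_shift summable_exp_shift')
open AffineAveraging (Form0 Form1 Form2 box toSite unitVec unitVec_apply dz curv curvAdj contourSum curv_dz)
open AffineReproduction (contourSumAdj)
open LatticeForm (quo)
open KKTFluctuationEnergy (contourSumAdj_eq)
open OneStepResolventKernel (Fib)
open OneStepKernelFamily (KInvStep)
open Summit.QuantumFields.BalabanUV.Beta.TameKernelCalculus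
open Summit.QuantumFields.BalabanUV.Beta.ChartConjugationRelative (RelInv spr_comp)
open Summit.QuantumFields.BalabanUV.Beta.AxialDressingRooted (IsCombBondAt axEc comp_axEc_apply spr_axEc coDressKBmAt spr_coDressKBmAt one_le_of_neZero)
open Summit.QuantumFields.BalabanUV.Beta.BorderedHessian (bhK fcol mcol fcol_apply mcol_apply comp_bhK_inl spr_bhK relInv_coDressKBmAt_KInvStep_zero)

namespace Summit.QuantumFields.BalabanUV.Beta.GAN24.RelInvWardPairing

variable {d : ℕ}

/-! ## §1 Adjointness with the bound on the other factor -/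

/-- [folklore] A bounded function times an absolutely summable one is summable. -/
theorem summable_bdd_mul {X : Type*} {f g : X → ℝ} {B : ℝ} (hf : ∀ u, |f u| ≤ B) (hg : Summable fun u => |g u|) :
    Summable fun u => f u * g u := by
  refine Summable.of_norm_bounded (hg.mul_left B) (fun u => ?_)
  rw [Real.norm_eq_abs, abs_mul]
  exact mul_le_mul (hf u) le_rfl (abs_nonneg _) ((abs_nonneg _).trans (hf u))

/-- [folklore] **`curvAdj` IS THE FORMAL ADJOINT OF `curv`, THE BOUND ON THE 1-FORM**: for a BOUNDED 1-form `r` and a 2-form `F` with absolutely summable components,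
`Σ'_u Σ_κ r κ u·(curvAdj F) κ u = Σ'_x Σ_κ Σ_l (curv r) κ l x·F κ l x` (leaf-02 g55's proof with the summability carried by `F`). -/
theorem tsum_mul_curvAdj_eq_tsum_curv_mul_bdd {r : Form1 (d + 1) ℝ} {B : ℝ} (hr : ∀ κ u, |r κ u| ≤ B) {F : Form2 (d + 1) ℝ}
    (hF : ∀ κ l, Summable fun x => |F κ l x|) :
    ∑' u, ∑ κ, r κ u * curvAdj F κ u = ∑' x, ∑ κ, ∑ l, curv r κ l x * F κ l x := by
  have hpiece : ∀ (κ : Fin (d + 1)) (c : Fin (d + 1) → ℤ) (g : (Fin (d + 1) → ℤ) → ℝ), (Summable fun u => |g u|) →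
      Summable fun u => r κ (u + c) * g u := fun κ c g hg => summable_bdd_mul (fun u => hr κ (u + c)) hg
  have hpiece0 : ∀ (κ : Fin (d + 1)) (g : (Fin (d + 1) → ℤ) → ℝ), (Summable fun u => |g u|) → Summable fun u => r κ u * g u := by
    intro κ g hg; simpa using hpiece κ 0 g hg
  have hFsh : ∀ κ l (c : Fin (d + 1) → ℤ), Summable fun u => |F κ l (u - c)| := fun κ l c =>
    (Equiv.subRight c).summable_iff.2 (hF κ l)
  have sP : ∀ κ l, Summable fun u => r κ u * F κ l u := fun κ l => hpiece0 κ (fun u => F κ l u) (hF κ l)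
  have sP' : ∀ κ l, Summable fun u => r κ u * F l κ u := fun κ l => hpiece0 κ (fun u => F l κ u) (hF l κ)
  have sQm : ∀ κ l, Summable fun u => r κ u * F κ l (u - unitVec l) := fun κ l => hpiece0 κ _ (hFsh κ l _)
  have sQm' : ∀ κ l, Summable fun u => r κ u * F l κ (u - unitVec l) := fun κ l => hpiece0 κ _ (hFsh l κ _)
  have sQ : ∀ κ l, Summable fun x => r κ (x + unitVec l) * F κ l x := fun κ l => hpiece κ _ (fun x => F κ l x) (hF κ l)
  have sQ' : ∀ κ l, Summable fun x => r κ (x + unitVec l) * F l κ x := fun κ l => hpiece κ _ (fun x => F l κ x) (hF l κ)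
  have shiftQ : ∀ κ l, ∑' u, r κ u * F κ l (u - unitVec l) = ∑' x, r κ (x + unitVec l) * F κ l x := by
    intro κ l
    rw [← (Equiv.addRight (unitVec l)).tsum_eq (fun u => r κ u * F κ l (u - unitVec l))]
    exact tsum_congr fun x => by simp
  have shiftQ' : ∀ κ l, ∑' u, r κ u * F l κ (u - unitVec l) = ∑' x, r κ (x + unitVec l) * F l κ x := by
    intro κ l
    rw [← (Equiv.addRight (unitVec l)).tsum_eq (fun u => r κ u * F l κ (u - unitVec l))]
    exact tsum_congr fun x => by simp
  have hL : ∀ u, ∑ κ, r κ u * curvAdj F κ u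
      = ∑ κ, ∑ l, (r κ u * F κ l u - r κ u * F κ l (u - unitVec l) + r κ u * F l κ (u - unitVec l) - r κ u * F l κ u) := by
    intro u
    refine Finset.sum_congr rfl fun κ _ => ?_
    simp only [AffineAveraging.curvAdj, Finset.mul_sum, ← Finset.sum_add_distrib]
    refine Finset.sum_congr rfl fun l _ => ?_
    ring
  have hL' : ∑' u, ∑ κ, r κ u * curvAdj F κ u
      = ∑ κ, ∑ l, ((∑' u, r κ u * F κ l u) - (∑' x, r κ (x + unitVec l) * F κ l x)
          + (∑' x, r κ (x + unitVec l) * F l κ x) - ∑' u, r κ u * F l κ u) := by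
    rw [tsum_congr hL, Summit.QuantumFields.BalabanUV.Beta.GAN24.FaceChargeCurlResummation.tsum_sum_sum_eq (fun κ l u => r κ u * F κ l u - r κ u * F κ l (u - unitVec l)
      + r κ u * F l κ (u - unitVec l) - r κ u * F l κ u) (fun κ l => (((sP κ l).sub (sQm κ l)).add (sQm' κ l)).sub (sP' κ l))]
    refine Finset.sum_congr rfl fun κ _ => Finset.sum_congr rfl fun l _ => ?_
    rw [((((sP κ l).sub (sQm κ l)).add (sQm' κ l))).tsum_sub (sP' κ l), ((sP κ l).sub (sQm κ l)).tsum_add (sQm' κ l),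
      (sP κ l).tsum_sub (sQm κ l), shiftQ, shiftQ']
  have hR : ∀ x, ∑ κ, ∑ l, curv r κ l x * F κ l x
      = ∑ κ, ∑ l, (r κ x * F κ l x + r l (x + unitVec κ) * F κ l x - r κ (x + unitVec l) * F κ l x - r l x * F κ l x) := by
    intro x
    refine Finset.sum_congr rfl fun κ _ => Finset.sum_congr rfl fun l _ => ?_
    simp only [AffineAveraging.curv]; ring
  have hR' : ∑' x, ∑ κ, ∑ l, curv r κ l x * F κ l x
      = ∑ κ, ∑ l, ((∑' u, r κ u * F κ l u) + (∑' x, r l (x + unitVec κ) * F κ l x)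
          - (∑' x, r κ (x + unitVec l) * F κ l x) - ∑' u, r l u * F κ l u) := by
    rw [tsum_congr hR, Summit.QuantumFields.BalabanUV.Beta.GAN24.FaceChargeCurlResummation.tsum_sum_sum_eq (fun κ l x => r κ x * F κ l x + r l (x + unitVec κ) * F κ l x
      - r κ (x + unitVec l) * F κ l x - r l x * F κ l x) (fun κ l => (((sP κ l).add (sQ' l κ)).sub (sQ κ l)).sub (sP' l κ))]
    refine Finset.sum_congr rfl fun κ _ => Finset.sum_congr rfl fun l _ => ?_
    rw [((((sP κ l).add (sQ' l κ)).sub (sQ κ l))).tsum_sub (sP' l κ), ((sP κ l).add (sQ' l κ)).tsum_sub (sQ κ l),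
      (sP κ l).tsum_add (sQ' l κ)]
  rw [hL', hR']
  have hswapA : ∑ κ : Fin (d + 1), ∑ l : Fin (d + 1), (∑' x, r κ (x + unitVec l) * F l κ x)
      = ∑ κ : Fin (d + 1), ∑ l : Fin (d + 1), (∑' x, r l (x + unitVec κ) * F κ l x) := Finset.sum_comm
  have hswapB : ∑ κ : Fin (d + 1), ∑ l : Fin (d + 1), (∑' u, r κ u * F l κ u)
      = ∑ κ : Fin (d + 1), ∑ l : Fin (d + 1), (∑' u, r l u * F κ l u) := Finset.sum_comm
  simp only [Finset.sum_sub_distrib, Finset.sum_add_distrib] at hswapA hswapB ⊢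
  rw [hswapA, hswapB]
  ring

/-- [folklore] The curvature of a 1-form with absolutely summable components has absolutely summable components (`curv A κ l = dz (A l) κ − dz (A κ) l`, leaf-02's
`summable_abs_dz_of_summable` twice). -/
theorem summable_abs_curv {A : Form1 (d + 1) ℝ} (hA : ∀ κ, Summable fun u => |A κ u|) (κ l : Fin (d + 1)) :
    Summable fun x => |curv A κ l x| := by
  have h1 := Summit.QuantumFields.BalabanUV.Beta.GAN24.FaceChargeCurlResummation.summable_abs_dz_of_summable (hA l) κ
  have h2 := Summit.QuantumFields.BalabanUV.Beta.GAN24.FaceChargeCurlResummation.summable_abs_dz_of_summable (hA κ) l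
  refine Summable.of_nonneg_of_le (fun x => abs_nonneg _) (fun x => ?_) (h1.add h2)
  have e : curv A κ l x = dz (A l) κ x - dz (A κ) l x := by
    simp only [AffineAveraging.curv, AffineAveraging.dz]; ring
  rw [e]
  exact abs_sub _ _

/-- NOT IN PRINT; OUR BOOKKEEPING.  **`(d*d)` IS SYMMETRIC BETWEEN A BOUNDED AND AN ABSOLUTELY SUMMABLE 1-FORM**: `Σ'_u Σ_κ m κ u·(curvAdj (curv A)) κ u = Σ'_u Σ_κ (curvAdj (curv m)) κ u·A κ u`
(`m` bounded, `A` with absolutely summable components; both sides equal `Σ'_x Σ_κ Σ_l (curv m)(curv A)`). -/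
theorem tsum_mul_curvAdj_curv_comm {m A : Form1 (d + 1) ℝ} {B : ℝ} (hm : ∀ κ u, |m κ u| ≤ B) (hA : ∀ κ, Summable fun u => |A κ u|) :
    ∑' u, ∑ κ, m κ u * curvAdj (curv A) κ u = ∑' u, ∑ κ, curvAdj (curv m) κ u * A κ u := by
  rw [tsum_mul_curvAdj_eq_tsum_curv_mul_bdd hm (fun κ l => summable_abs_curv hA κ l)]
  have h2 := Summit.QuantumFields.BalabanUV.Beta.GAN24.FaceChargeCurlResummation.tsum_mul_curvAdj_eq_tsum_curv_mul hA
    (F := curv m) (B := 4 * B) (fun κ l x => KKTFluctuationEnergy.abs_curv_le hm κ l x)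
  have e : (fun u => ∑ κ, curvAdj (curv m) κ u * A κ u) = fun u => ∑ κ, A κ u * curvAdj (curv m) κ u := by
    funext u; exact Finset.sum_congr rfl fun κ _ => mul_comm _ _
  rw [e, h2]
  exact tsum_congr fun x => Finset.sum_congr rfl fun κ _ => Finset.sum_congr rfl fun l _ => mul_comm _ _

/-- [folklore] `curvAdj` of a 2-form with absolutely summable components has absolutely summable components. -/
theorem summable_abs_curvAdj {F : Form2 (d + 1) ℝ} (hF : ∀ κ l, Summable fun x => |F κ l x|) (μ : Fin (d + 1)) :
    Summable fun y => |curvAdj F μ y| := by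
  have hsh : ∀ κ l (c : Fin (d + 1) → ℤ), Summable fun y => |F κ l (y - c)| := fun κ l c => (Equiv.subRight c).summable_iff.2 (hF κ l)
  have hmaj : Summable fun y => (∑ l, (|F μ l y| + |F μ l (y - unitVec l)|)) + ∑ κ, (|F κ μ (y - unitVec κ)| + |F κ μ y|) :=
    (summable_sum fun l _ => (hF μ l).add (hsh μ l _)).add (summable_sum fun κ _ => (hsh κ μ _).add (hF κ μ))
  refine Summable.of_nonneg_of_le (fun y => abs_nonneg _) (fun y => ?_) hmaj
  simp only [AffineAveraging.curvAdj]
  refine (abs_add_le _ _).trans (add_le_add ?_ ?_)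
  · refine (Finset.abs_sum_le_sum_abs _ _).trans (Finset.sum_le_sum fun l _ => abs_sub _ _)
  · refine (Finset.abs_sum_le_sum_abs _ _).trans (Finset.sum_le_sum fun κ _ => ?_)
    exact (abs_sub _ _).trans (le_of_eq (by ring))

/-- [folklore] **ADJOINTNESS OF THE STRAIGHT-CONTOUR BLOCK SUM, THE BOUND ON THE FINE FORM**: for a BOUNDED fine 1-form `m` and a coarse 1-form `φ` whose pull-back along the block map
is absolutely summable, `Σ'_u Σ_κ m κ u·(𝒬ᵀ_N φ) κ u = Σ'_y Σ_κ φ κ y·(𝒬_N m) κ y` (the mirror of `KKTFluctuationEnergy.lip1_contourSumAdj`; shift by `s•e_κ`, block regrouping). -/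
theorem tsum_mul_contourSumAdj_bdd {N : ℕ} [NeZero N] {m φ : Form1 (d + 1) ℝ} {B : ℝ} (hm : ∀ κ u, |m κ u| ≤ B)
    (hφ : ∀ κ, Summable fun u : Fin (d + 1) → ℤ => |φ κ (quo N u)|) :
    ∑' u, ∑ κ, m κ u * contourSumAdj N φ κ u = ∑' y, ∑ κ, φ κ y * contourSum N m κ y := by
  have hφs : ∀ κ (c : Fin (d + 1) → ℤ), Summable fun u : Fin (d + 1) → ℤ => |φ κ (quo N (u - c))| := fun κ c =>
    (Equiv.subRight c).summable_iff.2 (hφ κ)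
  have hw : ∀ κ (s : ℕ), Summable fun u => m κ u * φ κ (quo N (u - (s : ℤ) • unitVec κ)) := fun κ s =>
    summable_bdd_mul (hm κ) (hφs κ _)
  have hw' : ∀ κ (s : ℕ), Summable fun v => m κ (v + (s : ℤ) • unitVec κ) * φ κ (quo N v) := fun κ s => by
    have h := (Equiv.addRight ((s : ℤ) • unitVec κ)).summable_iff.2 (hw κ s)
    refine h.congr (fun v => ?_)
    simp
  have hshift : ∀ κ (s : ℕ), ∑' u, m κ u * φ κ (quo N (u - (s : ℤ) • unitVec κ)) = ∑' v, m κ (v + (s : ℤ) • unitVec κ) * φ κ (quo N v) := by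
    intro κ s
    rw [← (Equiv.addRight ((s : ℤ) • unitVec κ)).tsum_eq (fun u => m κ u * φ κ (quo N (u - (s : ℤ) • unitVec κ)))]
    exact tsum_congr fun v => by simp
  have hb : ∀ κ (s : ℕ), Summable fun y => ∑ b ∈ box (d + 1) N, m κ ((N : ℤ) • y + toSite b + (s : ℤ) • unitVec κ) * φ κ y := fun κ s => by
    have h := KKTFluctuationEnergy.summable_blocks (N := N) (hw' κ s)
    refine h.congr (fun y => Finset.sum_congr rfl fun b hb => ?_)
    rw [KKTFluctuationEnergy.quo_zsmul_add_toSite (N := N) y hb]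
  calc ∑' u, ∑ κ, m κ u * contourSumAdj N φ κ u
      = ∑' u, ∑ κ, ∑ s ∈ Finset.range N, m κ u * φ κ (quo N (u - (s : ℤ) • unitVec κ)) := by
        refine tsum_congr (fun u => Finset.sum_congr rfl (fun κ _ => ?_))
        rw [contourSumAdj_eq, Finset.mul_sum]
    _ = ∑ κ, ∑ s ∈ Finset.range N, ∑' u, m κ u * φ κ (quo N (u - (s : ℤ) • unitVec κ)) := by
        rw [Summable.tsum_finsetSum (fun κ _ => summable_sum fun s _ => hw κ s)]
        exact Finset.sum_congr rfl fun κ _ => Summable.tsum_finsetSum (fun s _ => hw κ s)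
    _ = ∑ κ, ∑ s ∈ Finset.range N, ∑' y, ∑ b ∈ box (d + 1) N, m κ ((N : ℤ) • y + toSite b + (s : ℤ) • unitVec κ) * φ κ y := by
        refine Finset.sum_congr rfl (fun κ _ => Finset.sum_congr rfl (fun s _ => ?_))
        rw [hshift, KKTFluctuationEnergy.tsum_blocks (N := N) (hw' κ s)]
        refine tsum_congr (fun y => Finset.sum_congr rfl (fun b hb => ?_))
        rw [KKTFluctuationEnergy.quo_zsmul_add_toSite (N := N) y hb]
    _ = ∑' y, ∑ κ, ∑ s ∈ Finset.range N, ∑ b ∈ box (d + 1) N, m κ ((N : ℤ) • y + toSite b + (s : ℤ) • unitVec κ) * φ κ y := by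
        rw [Summable.tsum_finsetSum (fun κ _ => summable_sum fun s _ => hb κ s)]
        exact Finset.sum_congr rfl fun κ _ => (Summable.tsum_finsetSum (fun s _ => hb κ s)).symm
    _ = ∑' y, ∑ κ, φ κ y * contourSum N m κ y := by
        refine tsum_congr (fun y => Finset.sum_congr rfl (fun κ _ => ?_))
        rw [AffineAveraging.contourSum, Finset.sum_comm, Finset.mul_sum]
        refine Finset.sum_congr rfl fun b _ => ?_
        rw [Finset.mul_sum]
        exact Finset.sum_congr rfl fun s _ => mul_comm _ _

/-- [folklore] The block representative is within `(d+1)·N` of the point in `ℓ¹`: `l1 (N•blk N u − u) ≤ (d + 1)·N` (`1 ≤ N`). -/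
theorem l1_zsmul_quo_sub_le {N : ℕ} (hN : 1 ≤ N) (u : Fin (d + 1) → ℤ) :
    l1 ((N : ℤ) • quo N u - u) ≤ ((d : ℝ) + 1) * N := by
  unfold B12Sec2to5.l1
  have hc : ∀ i : Fin (d + 1), |((((N : ℤ) • quo N u - u) i : ℤ) : ℝ)| ≤ N := by
    intro i
    have h1 := AxialProjector.zsmul_blk_le hN u i
    have h2 := AxialProjector.lt_zsmul_blk_add hN u i
    have e : ((N : ℤ) • quo N u - u) i = ((N : ℤ) • AveragingContours.blk N u) i - u i := rfl
    rw [e, abs_le]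
    constructor
    · have : (-(N : ℤ)) ≤ ((N : ℤ) • AveragingContours.blk N u) i - u i := by linarith
      exact_mod_cast this
    · have : ((N : ℤ) • AveragingContours.blk N u) i - u i ≤ (N : ℤ) := by linarith
      exact_mod_cast this
  calc ∑ i, |((((N : ℤ) • quo N u - u) i : ℤ) : ℝ)| ≤ ∑ _i : Fin (d + 1), (N : ℝ) := Finset.sum_le_sum fun i _ => hc i
    _ = ((d : ℝ) + 1) * N := by rw [Finset.sum_const, Finset.card_univ, Fintype.card_fin, nsmul_eq_mul]; push_cast; ring

/-- [folklore] A kernel column decaying from `x` is absolutely summable when read on the block representatives `N•quo N u`. -/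
theorem summable_abs_comp_quo {N : ℕ} (hN : 1 ≤ N) {V : MKer (d + 1) (Fib d)} {C δ : ℝ} (hδ : 0 < δ) (hV : Decays V C δ)
    (x : Fin (d + 1) → ℤ) (a b : Fib d) :
    Summable fun u : Fin (d + 1) → ℤ => |V ((N : ℤ) • quo N u) x a b| := by
  refine Summable.of_nonneg_of_le (fun u => abs_nonneg _)
    (fun u => ?_) (((summable_exp_shift' hδ x).mul_left (C * Real.exp (δ * (((d : ℝ) + 1) * N)))))
  have h := hV ((N : ℤ) • quo N u) x a b
  have htri : l1 (u - x) ≤ l1 (u - (N : ℤ) • quo N u) + l1 ((N : ℤ) • quo N u - x) := ExpKernelCalculus.l1_sub_triangle _ _ _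
  have hq : l1 (u - (N : ℤ) • quo N u) ≤ ((d : ℝ) + 1) * N := by
    rw [ExpKernelCalculus.l1_sub_symm]; exact l1_zsmul_quo_sub_le hN u
  have hC : 0 ≤ C := by
    have := (abs_nonneg _).trans (hV x x a a)
    have hx0 : l1 (x - x) = 0 := by simp [B12Sec2to5.l1]
    rw [hx0, mul_zero, Real.exp_zero, mul_one] at this
    exact this
  calc |V ((N : ℤ) • quo N u) x a b| ≤ C * Real.exp (-δ * l1 ((N : ℤ) • quo N u - x)) := h
    _ ≤ C * (Real.exp (δ * (((d : ℝ) + 1) * N)) * Real.exp (-δ * l1 (u - x))) := by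
        refine mul_le_mul_of_nonneg_left ?_ hC
        rw [← Real.exp_add]
        exact Real.exp_le_exp.2 (by nlinarith)
    _ = C * Real.exp (δ * (((d : ℝ) + 1) * N)) * Real.exp (-δ * l1 (u - x)) := by ring

/-! ## §2 The field rows of the relative inverse -/

/-- NOT IN PRINT; OUR BOOKKEEPING.  **THE EULER–LAGRANGE ROWS OF THE RELATIVE INVERSE**: if `RelInv G (bhK N) (axEc ρ N)` (an2 gen 13's rules; rule 4 `(E∘𝕄)∘G = E`), then for every
spread `W` and every NON-comb bond `(κ, u)` the `(κ,u)`-field row of `𝕄 ∘ (G ∘ W)` is the row of `W`: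
`(d*d (G∘W)^F_{·xb})_κ(u) − (𝒬ᵀ_N (G∘W)^M_{·xb})_κ(u) = W u x (inl κ) b` (action lemma `comp_bhK_inl` + the diagonal `E`). -/
theorem fieldRow_eq_of_relInv {N : ℕ} [NeZero N] {ρ : Fin (d + 1) → ℤ} {G W : MKer (d + 1) (Fib d)}
    (hG : RelInv G (bhK N) (axEc ρ N)) (hGs : Spr G) (hWs : Spr W) {κ : Fin (d + 1)} {u : Fin (d + 1) → ℤ}
    (hu : ¬ IsCombBondAt ρ N κ u) (x : Fin (d + 1) → ℤ) (b : Fib d) :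
    curvAdj (curv (fcol (comp G W) x b)) κ u - contourSumAdj N (mcol N (comp G W) x b) κ u = W u x (Sum.inl κ) b := by
  have hN : 1 ≤ N := one_le_of_neZero N
  have hE : Spr (axEc ρ N) := spr_axEc ρ N
  have hB : Spr (bhK (d := d) N) := spr_bhK hN
  have hV : Spr (comp G W) := spr_comp hGs hWs
  have key : comp (comp (axEc ρ N) (bhK N)) (comp G W) = comp (axEc ρ N) W := by
    rw [comp_assoc_tame (spr_comp hE hB).tame hGs.tame hWs.tame, hG.2.2.2]
  have key' : comp (axEc ρ N) (comp (bhK N) (comp G W)) = comp (axEc ρ N) W := by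
    rw [comp_assoc_tame hE.tame hB.tame hV.tame]; exact key
  have e1 := congrArg (fun K => K u x (Sum.inl κ) b) key'
  simp only [comp_axEc_apply, hu, if_false] at e1
  rw [comp_bhK_inl] at e1
  exact e1

/-! ## §3 The Ward pairing -/

/-- NOT IN PRINT; OUR BOOKKEEPING.  **THE RELATIVE-INVERSE WARD PAIRING**: `RelInv G (bhK N) (axEc ρ N)`, `G`, `W` spread, `m` a BOUNDED fine 1-form VANISHING ON THE COMB BONDS
(hard axial gauge); then for every `(x, b)`
`Σ'_u Σ_κ (d*d m) κ u·(G∘W) u x (inl κ) b = Σ'_u Σ_κ m κ u·W u x (inl κ) b + Σ'_y Σ_κ (𝒬_N m) κ y·(G∘W) (N•y) x (inr κ) b` —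
the `(d*d)`-image of `m` read against a field column of `G∘W` is the source column read against `m` plus the block contour sums of `m` read against the MULTIPLIER column.
(`m` meets only non-comb rows, where §2 holds; `d*d` and `𝒬ᵀ_N` are moved onto `m` by §1.) -/
theorem ward_pairing {N : ℕ} [NeZero N] {ρ : Fin (d + 1) → ℤ} {G W : MKer (d + 1) (Fib d)}
    (hG : RelInv G (bhK N) (axEc ρ N)) (hGs : Spr G) (hWs : Spr W) {m : Form1 (d + 1) ℝ} {B : ℝ} (hmB : ∀ κ u, |m κ u| ≤ B)
    (hm0 : ∀ κ u, IsCombBondAt ρ N κ u → m κ u = 0) (x : Fin (d + 1) → ℤ) (b : Fib d) :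
    ∑' u, ∑ κ, curvAdj (curv m) κ u * comp G W u x (Sum.inl κ) b
      = (∑' u, ∑ κ, m κ u * W u x (Sum.inl κ) b) + ∑' y, ∑ κ, contourSum N m κ y * comp G W ((N : ℤ) • y) x (Sum.inr κ) b := by
  classical
  have hN : 1 ≤ N := one_le_of_neZero N
  obtain ⟨C, δ, hδ, hVd⟩ := spr_comp hGs hWs
  -- summabilities
  have hF : ∀ κ, Summable fun u => |fcol (comp G W) x b κ u| := fun κ => by
    refine Summable.of_nonneg_of_le (fun u => abs_nonneg _) (fun u => hVd u x (Sum.inl κ) b) ((summable_exp_shift' hδ x).mul_left C)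
  have hφ : ∀ κ, Summable fun u : Fin (d + 1) → ℤ => |mcol N (comp G W) x b κ (quo N u)| := fun κ =>
    summable_abs_comp_quo hN hδ hVd x (Sum.inr κ) b
  have hφs : ∀ κ (c : Fin (d + 1) → ℤ), Summable fun u : Fin (d + 1) → ℤ => |mcol N (comp G W) x b κ (quo N (u - c))| := fun κ c =>
    (Equiv.subRight c).summable_iff.2 (hφ κ)
  have s1 : Summable fun u => ∑ κ, m κ u * curvAdj (curv (fcol (comp G W) x b)) κ u :=
    summable_sum fun κ _ => summable_bdd_mul (hmB κ) (summable_abs_curvAdj (fun κ' l => summable_abs_curv hF κ' l) κ)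
  have s2 : Summable fun u => ∑ κ, m κ u * contourSumAdj N (mcol N (comp G W) x b) κ u := by
    refine summable_sum fun κ _ => ?_
    have e : (fun u => m κ u * contourSumAdj N (mcol N (comp G W) x b) κ u)
        = fun u => ∑ s ∈ Finset.range N, m κ u * mcol N (comp G W) x b κ (quo N (u - (s : ℤ) • unitVec κ)) := by
      funext u; rw [contourSumAdj_eq, Finset.mul_sum]
    rw [e]
    exact summable_sum fun s _ => summable_bdd_mul (hmB κ) (hφs κ _)
  -- the pointwise identity, summed
  have hpt : ∀ u, (∑ κ, m κ u * curvAdj (curv (fcol (comp G W) x b)) κ u) - (∑ κ, m κ u * contourSumAdj N (mcol N (comp G W) x b) κ u)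
      = ∑ κ, m κ u * W u x (Sum.inl κ) b := by
    intro u
    rw [← Finset.sum_sub_distrib]
    refine Finset.sum_congr rfl fun κ _ => ?_
    by_cases hc : IsCombBondAt ρ N κ u
    · simp [hm0 κ u hc]
    · rw [← mul_sub, fieldRow_eq_of_relInv hG hGs hWs hc x b]
  have hsum : (∑' u, ∑ κ, m κ u * curvAdj (curv (fcol (comp G W) x b)) κ u)
      - (∑' u, ∑ κ, m κ u * contourSumAdj N (mcol N (comp G W) x b) κ u) = ∑' u, ∑ κ, m κ u * W u x (Sum.inl κ) b := by
    rw [← s1.tsum_sub s2]; exact tsum_congr hpt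
  -- move the operators onto `m`
  rw [tsum_mul_curvAdj_curv_comm hmB hF] at hsum
  rw [tsum_mul_contourSumAdj_bdd hmB hφ] at hsum
  have e2 : (fun y => ∑ κ, mcol N (comp G W) x b κ y * contourSum N m κ y)
      = fun y => ∑ κ, contourSum N m κ y * comp G W ((N : ℤ) • y) x (Sum.inr κ) b := by
    funext y; exact Finset.sum_congr rfl fun κ _ => by rw [mcol_apply, mul_comm]
  rw [e2] at hsum
  have e3 : (fun u => ∑ κ, curvAdj (curv m) κ u * fcol (comp G W) x b κ u) = fun u => ∑ κ, curvAdj (curv m) κ u * comp G W u x (Sum.inl κ) b := by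
    funext u; rfl
  rw [e3] at hsum
  linarith

/-! ## §4 The instance `G₀ = coDressKBmAt (toSite r) Lc (KInvStep Lc 0)` -/

/-- NOT IN PRINT; OUR BOOKKEEPING.  **THE WARD PAIRING FOR THE CO-DRESSED ONE-STEP RESOLVENT** `G₀ = coDressKBmAt (toSite r) Lc (KInvStep Lc 0)` (in-block root): an2 gen 13's
`relInv_coDressKBmAt_KInvStep_zero` + `spr_coDressKBmAt` BY NAME in `ward_pairing`, for every spread `W` and every bounded `m` vanishing on the comb bonds of the root. -/
theorem ward_pairing_coDressKBmAt_KInvStep_zero {Lc : ℕ} [NeZero Lc] {r : Fin (d + 1) → ℕ} (hr : r ∈ box (d + 1) Lc)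
    {W : MKer (d + 1) (Fib d)} (hWs : Spr W) {m : Form1 (d + 1) ℝ} {B : ℝ} (hmB : ∀ κ u, |m κ u| ≤ B)
    (hm0 : ∀ κ u, IsCombBondAt (toSite r) Lc κ u → m κ u = 0) (x : Fin (d + 1) → ℤ) (b : Fib d) :
    ∑' u, ∑ κ, curvAdj (curv m) κ u * comp (coDressKBmAt (toSite r) Lc (KInvStep (d := d) Lc 0)) W u x (Sum.inl κ) b
      = (∑' u, ∑ κ, m κ u * W u x (Sum.inl κ) b)
        + ∑' y, ∑ κ, contourSum Lc m κ y * comp (coDressKBmAt (toSite r) Lc (KInvStep (d := d) Lc 0)) W ((Lc : ℤ) • y) x (Sum.inr κ) b :=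
  ward_pairing (relInv_coDressKBmAt_KInvStep_zero hr) (spr_coDressKBmAt (one_le_of_neZero Lc) hr
    (by obtain ⟨δ, C, hδ, -, h⟩ := OneStepKernelFamily.decays_KInvStep (d := d) (Lc := Lc) 0; exact ⟨C, δ, hδ, h⟩)) hWs hmB hm0 x b

end Summit.QuantumFields.BalabanUV.Beta.GAN24.RelInvWardPairing

end
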